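import Literature.NumberTheory.EllipticCurves.CPMuDescentQBoxNodeKillBooking
import Literature.NumberTheory.EllipticCurves.CPMuDescentK3BoxDoubleKill
import HarnessLib

/-!
# Booking `t_3 = 0` with the ℚ-side local condition and a `K3`-box cut TWICE (Cohen–Pazuki 2009, Prop. 2.2 with local images on both sides)

Topic `NumberTheory/EllipticCurves`. Compositions of `forall_mem_sha_three_nsmul_eq_zero_of_QKill_of_box` (`CPMuDescentQBoxNodeKillBooking`) with
the doubly-cut `K3`-boxes of `CPMuDescentK3BoxDoubleKill`:
* **`shaCorank_three_eq_zero_of_QKill_split_doubleKill`** — ℚ-box cut at a node prime; ONE split prime in `b̂`, two `K3`-killing places with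
  independent certificates: NO `K3`-point (census shape `|S| = 4`, e.g. 198660c1, 291410h1, 81130x3);
* **`shaCorank_three_eq_zero_of_QKill_split₂_doubleKill`** — ℚ-box cut at a node prime; TWO split primes, two `K3`-killing places, ONE
  `K3`-point (census shape `|S| = 3`, e.g. 110670bl1, 115430r1, 254980b1).
Theorems only; no definitions, no named facts.

## References
* [CohenPazuki2009] H. Cohen, F. Pazuki, *Elementary 3-descent with a 3-isogeny*, Acta Arith. 140 (2009), Thm. 2.1, Prop. 2.2.
* [SilvermanAEC2009] J. H. Silverman, *The Arithmetic of Elliptic Curves*, 2nd ed. (2009), Thm. X.4.2 (a), Prop. X.4.9.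
-/

noncomputable section

open scoped Classical
open WeierstrassCurve IsDedekindDomain IsDedekindDomain.HeightOneSpectrum NumberField

namespace Literature.NumberTheory.EllipticCurves

namespace CPMuDescent

open MordellDescent ThreeTorsionDescent MuThreeKernel WithZero
open Literature.NumberTheory.NumberFields Literature.NumberTheory.NumberFields.K3

/-- Reassociation under the cast (private). [cite: CohenPazuki2009, Theorem 2.1 (2)] -/
private theorem not_mem_assocD {N p : ℕ} {w : HeightOneSpectrum (𝓞 K3)} (hw : ((3 * N * p : ℕ) : 𝓞 K3) ∉ w.asIdeal) :
    ((3 * (N * p) : ℕ) : 𝓞 K3) ∉ w.asIdeal := by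
  rwa [← mul_assoc]

/-- Reassociation under the cast (private). [cite: CohenPazuki2009, Theorem 2.1 (2)] -/
private theorem not_mem_assocD₂ {N p₁ p₂ : ℕ} {w : HeightOneSpectrum (𝓞 K3)}
    (hw : ((3 * N * p₁ * p₂ : ℕ) : 𝓞 K3) ∉ w.asIdeal) : ((3 * (N * p₁ * p₂) : ℕ) : 𝓞 K3) ∉ w.asIdeal := by
  rwa [← mul_assoc, ← mul_assoc]

/-! ## ℚ-kill × (one split prime, two killing places, no `K3`-point) -/

/-- **`Ш(E/ℚ)[3] = 0` for `E = threeTorsionModel m s`: ℚ-box cut at the node prime `p₀`; `K3`-box `⟨[ζ], [ϖϖ̄²]⟩` killed entirely by two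
killing places `w₀, w₁ ∣ s` with independent certificates.** [cite: CohenPazuki2009, Theorem 2.1 and Proposition 2.2] [cite: SilvermanAEC2009, Thm. X.4.2 (a)] -/
theorem forall_mem_sha_three_nsmul_eq_zero_of_QKill_split_doubleKill {m s : ℚ} [(threeTorsionModel m s).IsElliptic]
    (S : Finset ℕ) (hS : ∀ q ∈ S, q.Prime)
    (hout : ∀ q : ℕ, q.Prime → q ∉ S → padicValRat q (2 * s) = 0 ∧ 0 ≤ padicValRat q (2 * m))
    {p₀ : ℕ} (hp₀ : p₀.Prime) (hp₀1 : p₀ % 3 = 1)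
    (hsp : padicValRat p₀ s = 0) (hDp : 0 < padicValRat p₀ (27 * s - 4 * m ^ 3))
    {g : ℕ} (hg : (g : ZMod p₀) ^ ((p₀ - 1) / 3) ≠ 1) (hg0 : (g : ZMod p₀) ≠ 0)
    (c y : ℕ → ℕ) (hcert : ∀ q ∈ S, ((q : ℕ) : ZMod p₀) = (g : ZMod p₀) ^ c q * ((y q : ℕ) : ZMod p₀) ^ 3)
    (hy0 : ∀ q ∈ S, ((y q : ℕ) : ZMod p₀) ≠ 0)
    {q₀ : ℕ} (hq₀ : q₀ ∈ S) (hc₀ : ¬ 3 ∣ c q₀) (f : ℕ → ℕ) (hf : ∀ q ∈ S, q ≠ q₀ → 3 ∣ c q + c q₀ * f q)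
    (hgenQ : ∀ q ∈ S, q ≠ q₀ → cubeClass ((q : ℚ) * (q₀ : ℚ) ^ f q) ∈ Subgroup.closure (Set.range
      fun P : (threeTorsionModel m s).toAffine.Point => descentClass (threeTorsionModel m s) m s P))
    {N : ℕ} (hN0 : N ≠ 0) (hN : ∀ q ∈ N.primeFactors, q = 2 ∨ q % 3 = 2)
    {p : ℕ} (hp : p.Prime) (hp1 : p % 3 = 1) {a b : ℤ} (hab : a ^ 2 - a * b + b ^ 2 = p)
    (hvb : ∀ w : HeightOneSpectrum (𝓞 K3), ((3 * N * p : ℕ) : 𝓞 K3) ∉ w.asIdeal →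
      w.valuation K3 (algebraMap ℚ K3 (2 * (3 * s - 4 * m ^ 3 / 9))) = 1)
    (hvm : ∀ w : HeightOneSpectrum (𝓞 K3), ((3 * N * p : ℕ) : 𝓞 K3) ∉ w.asIdeal →
      w.valuation K3 (algebraMap ℚ K3 (2 * m)) ≤ 1)
    (w₀ : HeightOneSpectrum (𝓞 K3)) (hw₀ : ((3 * N * p : ℕ) : 𝓞 K3) ∉ w₀.asIdeal) (hw₀2 : w₀.valuation K3 2 = 1)
    (hw₀s : w₀.valuation K3 (algebraMap ℚ K3 s) < 1) (hw₀9 : ¬ 9 ∣ Ideal.absNorm w₀.asIdeal - 1)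
    {c₀ : ℕ} {y₀ : 𝓞 K3} (hcertK : mkInt a b * mkInt (a - b) (-b) ^ 2 - zetaInt ^ c₀ * y₀ ^ 3 ∈ w₀.asIdeal)
    (w₁ : HeightOneSpectrum (𝓞 K3)) (hw₁ : ((3 * N * p : ℕ) : 𝓞 K3) ∉ w₁.asIdeal) (hw₁2 : w₁.valuation K3 2 = 1)
    (hw₁s : w₁.valuation K3 (algebraMap ℚ K3 s) < 1) (hw₁9 : ¬ 9 ∣ Ideal.absNorm w₁.asIdeal - 1)
    {c₀' : ℕ} {y₀' : 𝓞 K3} (hcertK' : mkInt a b * mkInt (a - b) (-b) ^ 2 - zetaInt ^ c₀' * y₀' ^ 3 ∈ w₁.asIdeal)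
    (hind : c₀ % 3 ≠ c₀' % 3) :
    ∀ c' ∈ (threeTorsionModel m s).sha, 3 • c' = 0 → c' = 0 :=
  forall_mem_sha_three_nsmul_eq_zero_of_QKill_of_box S hS hout hp₀ hp₀1 hsp hDp hg hg0 c y hcert hy0 hq₀ hc₀ f hf hgenQ
    (fun θ₀ => -(algebraMap ℚ K3 m / 3) * θ₀) (fun θ₀ => -(algebraMap ℚ K3 s / 3) * θ₀)
    (fun _ hθ => canonical₃_b_ne_zero (m := m) hθ) (fun _ hθ => canonical₃_d_ne_zero hθ)
    (fun _ hθ => canonical₃_baseChange_eq hθ) (fun _ hθ => canonical₃_hy hθ)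
    (fun θ₀ hθ _ hu hsha hnorm => torsorClass_eq_zero_of_mem_sha_of_norm_cube_of_split_doubleKill hN0 hN hp hp1 hab
      (canonical₃_b_ne_zero (m := m) hθ) (canonical₃_d_ne_zero hθ) (t := -1) (by norm_num) canonical₃_hm
      (canonical₃_hs hθ) (fun w hw => canonical₃_valuation_s hθ (not_mem_assocD hw) (hvb w hw))
      (fun w hw => canonical₃_valuation_m hθ (not_mem_assocD hw) (hvm w hw))
      w₀ hw₀ hw₀2 (canonical₃_valuation_s₃ hθ (not_mem_assocD hw₀) hw₀2 (hvb w₀ hw₀))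
      (canonical₃_valuation_D hθ (not_mem_assocD hw₀) hw₀s) hw₀9 hcertK
      w₁ hw₁ hw₁2 (canonical₃_valuation_s₃ hθ (not_mem_assocD hw₁) hw₁2 (hvb w₁ hw₁))
      (canonical₃_valuation_D hθ (not_mem_assocD hw₁) hw₁s) hw₁9 hcertK' hind hu hsha hnorm)

/-- **`t_3(E_{m,s}) = 0` BOOKED: cut ℚ-box, one split prime, two `K3`-killing places, no `K3`-point.**
[cite: CohenPazuki2009, Proposition 2.2] [cite: SilvermanAEC2009, Thm. X.4.2 (a)] -/
theorem shaCorank_three_eq_zero_of_QKill_split_doubleKill {m s : ℚ} [(threeTorsionModel m s).IsElliptic]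
    (S : Finset ℕ) (hS : ∀ q ∈ S, q.Prime)
    (hout : ∀ q : ℕ, q.Prime → q ∉ S → padicValRat q (2 * s) = 0 ∧ 0 ≤ padicValRat q (2 * m))
    {p₀ : ℕ} (hp₀ : p₀.Prime) (hp₀1 : p₀ % 3 = 1)
    (hsp : padicValRat p₀ s = 0) (hDp : 0 < padicValRat p₀ (27 * s - 4 * m ^ 3))
    {g : ℕ} (hg : (g : ZMod p₀) ^ ((p₀ - 1) / 3) ≠ 1) (hg0 : (g : ZMod p₀) ≠ 0)
    (c y : ℕ → ℕ) (hcert : ∀ q ∈ S, ((q : ℕ) : ZMod p₀) = (g : ZMod p₀) ^ c q * ((y q : ℕ) : ZMod p₀) ^ 3)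
    (hy0 : ∀ q ∈ S, ((y q : ℕ) : ZMod p₀) ≠ 0)
    {q₀ : ℕ} (hq₀ : q₀ ∈ S) (hc₀ : ¬ 3 ∣ c q₀) (f : ℕ → ℕ) (hf : ∀ q ∈ S, q ≠ q₀ → 3 ∣ c q + c q₀ * f q)
    (hgenQ : ∀ q ∈ S, q ≠ q₀ → cubeClass ((q : ℚ) * (q₀ : ℚ) ^ f q) ∈ Subgroup.closure (Set.range
      fun P : (threeTorsionModel m s).toAffine.Point => descentClass (threeTorsionModel m s) m s P))
    {N : ℕ} (hN0 : N ≠ 0) (hN : ∀ q ∈ N.primeFactors, q = 2 ∨ q % 3 = 2)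
    {p : ℕ} (hp : p.Prime) (hp1 : p % 3 = 1) {a b : ℤ} (hab : a ^ 2 - a * b + b ^ 2 = p)
    (hvb : ∀ w : HeightOneSpectrum (𝓞 K3), ((3 * N * p : ℕ) : 𝓞 K3) ∉ w.asIdeal →
      w.valuation K3 (algebraMap ℚ K3 (2 * (3 * s - 4 * m ^ 3 / 9))) = 1)
    (hvm : ∀ w : HeightOneSpectrum (𝓞 K3), ((3 * N * p : ℕ) : 𝓞 K3) ∉ w.asIdeal →
      w.valuation K3 (algebraMap ℚ K3 (2 * m)) ≤ 1)
    (w₀ : HeightOneSpectrum (𝓞 K3)) (hw₀ : ((3 * N * p : ℕ) : 𝓞 K3) ∉ w₀.asIdeal) (hw₀2 : w₀.valuation K3 2 = 1)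
    (hw₀s : w₀.valuation K3 (algebraMap ℚ K3 s) < 1) (hw₀9 : ¬ 9 ∣ Ideal.absNorm w₀.asIdeal - 1)
    {c₀ : ℕ} {y₀ : 𝓞 K3} (hcertK : mkInt a b * mkInt (a - b) (-b) ^ 2 - zetaInt ^ c₀ * y₀ ^ 3 ∈ w₀.asIdeal)
    (w₁ : HeightOneSpectrum (𝓞 K3)) (hw₁ : ((3 * N * p : ℕ) : 𝓞 K3) ∉ w₁.asIdeal) (hw₁2 : w₁.valuation K3 2 = 1)
    (hw₁s : w₁.valuation K3 (algebraMap ℚ K3 s) < 1) (hw₁9 : ¬ 9 ∣ Ideal.absNorm w₁.asIdeal - 1)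
    {c₀' : ℕ} {y₀' : 𝓞 K3} (hcertK' : mkInt a b * mkInt (a - b) (-b) ^ 2 - zetaInt ^ c₀' * y₀' ^ 3 ∈ w₁.asIdeal)
    (hind : c₀ % 3 ≠ c₀' % 3) :
    (threeTorsionModel m s).shaCorank 3 = 0 :=
  haveI : Fact (Nat.Prime 3) := ⟨Nat.prime_three⟩
  shaCorank_eq_zero_of_forall _ 3 (forall_mem_sha_three_nsmul_eq_zero_of_QKill_split_doubleKill S hS hout hp₀ hp₀1 hsp hDp hg hg0 c y hcert hy0 hq₀ hc₀ f hf hgenQ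
    hN0 hN hp hp1 hab hvb hvm w₀ hw₀ hw₀2 hw₀s hw₀9 hcertK w₁ hw₁ hw₁2 hw₁s hw₁9 hcertK' hind)

/-! ## ℚ-kill × (two split primes, two killing places, one `K3`-point) -/

/-- **`Ш(E/ℚ)[3] = 0` for `E = threeTorsionModel m s`: ℚ-box cut at the node prime `p₀`; `K3`-box `⟨[ζ], [ϖ₁ϖ̄₁²], [ϖ₂ϖ̄₂²]⟩` cut to a line by
two killing places (survivor table), ONE `K3`-point on that line.** [cite: CohenPazuki2009, Theorem 2.1 and Proposition 2.2] [cite: SilvermanAEC2009, Thm. X.4.2 (a)] -/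
theorem forall_mem_sha_three_nsmul_eq_zero_of_QKill_split₂_doubleKill {m s : ℚ} [(threeTorsionModel m s).IsElliptic]
    (S : Finset ℕ) (hS : ∀ q ∈ S, q.Prime)
    (hout : ∀ q : ℕ, q.Prime → q ∉ S → padicValRat q (2 * s) = 0 ∧ 0 ≤ padicValRat q (2 * m))
    {p₀ : ℕ} (hp₀ : p₀.Prime) (hp₀1 : p₀ % 3 = 1)
    (hsp : padicValRat p₀ s = 0) (hDp : 0 < padicValRat p₀ (27 * s - 4 * m ^ 3))
    {g : ℕ} (hg : (g : ZMod p₀) ^ ((p₀ - 1) / 3) ≠ 1) (hg0 : (g : ZMod p₀) ≠ 0)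
    (c y : ℕ → ℕ) (hcert : ∀ q ∈ S, ((q : ℕ) : ZMod p₀) = (g : ZMod p₀) ^ c q * ((y q : ℕ) : ZMod p₀) ^ 3)
    (hy0 : ∀ q ∈ S, ((y q : ℕ) : ZMod p₀) ≠ 0)
    {q₀ : ℕ} (hq₀ : q₀ ∈ S) (hc₀ : ¬ 3 ∣ c q₀) (f : ℕ → ℕ) (hf : ∀ q ∈ S, q ≠ q₀ → 3 ∣ c q + c q₀ * f q)
    (hgenQ : ∀ q ∈ S, q ≠ q₀ → cubeClass ((q : ℚ) * (q₀ : ℚ) ^ f q) ∈ Subgroup.closure (Set.range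
      fun P : (threeTorsionModel m s).toAffine.Point => descentClass (threeTorsionModel m s) m s P))
    {N : ℕ} (hN0 : N ≠ 0) (hN : ∀ q ∈ N.primeFactors, q = 2 ∨ q % 3 = 2)
    {p₁ : ℕ} (hp₁ : p₁.Prime) (hp₁1 : p₁ % 3 = 1) {a₁ b₁ : ℤ} (hab₁ : a₁ ^ 2 - a₁ * b₁ + b₁ ^ 2 = p₁)
    {p₂ : ℕ} (hp₂ : p₂.Prime) (hp₂1 : p₂ % 3 = 1) {a₂ b₂ : ℤ} (hab₂ : a₂ ^ 2 - a₂ * b₂ + b₂ ^ 2 = p₂) (hne : p₁ ≠ p₂)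
    (hvb : ∀ w : HeightOneSpectrum (𝓞 K3), ((3 * N * p₁ * p₂ : ℕ) : 𝓞 K3) ∉ w.asIdeal →
      w.valuation K3 (algebraMap ℚ K3 (2 * (3 * s - 4 * m ^ 3 / 9))) = 1)
    (hvm : ∀ w : HeightOneSpectrum (𝓞 K3), ((3 * N * p₁ * p₂ : ℕ) : 𝓞 K3) ∉ w.asIdeal →
      w.valuation K3 (algebraMap ℚ K3 (2 * m)) ≤ 1)
    (w₀ : HeightOneSpectrum (𝓞 K3)) (hw₀ : ((3 * N * p₁ * p₂ : ℕ) : 𝓞 K3) ∉ w₀.asIdeal) (hw₀2 : w₀.valuation K3 2 = 1)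
    (hw₀s : w₀.valuation K3 (algebraMap ℚ K3 s) < 1) (hw₀9 : ¬ 9 ∣ Ideal.absNorm w₀.asIdeal - 1)
    {c₁ c₂ : ℕ} {y₁ y₂ : 𝓞 K3} (hcert₁ : mkInt a₁ b₁ * mkInt (a₁ - b₁) (-b₁) ^ 2 - zetaInt ^ c₁ * y₁ ^ 3 ∈ w₀.asIdeal)
    (hcert₂ : mkInt a₂ b₂ * mkInt (a₂ - b₂) (-b₂) ^ 2 - zetaInt ^ c₂ * y₂ ^ 3 ∈ w₀.asIdeal)
    (w₁ : HeightOneSpectrum (𝓞 K3)) (hw₁ : ((3 * N * p₁ * p₂ : ℕ) : 𝓞 K3) ∉ w₁.asIdeal) (hw₁2 : w₁.valuation K3 2 = 1)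
    (hw₁s : w₁.valuation K3 (algebraMap ℚ K3 s) < 1) (hw₁9 : ¬ 9 ∣ Ideal.absNorm w₁.asIdeal - 1)
    {c₁' c₂' : ℕ} {y₁' y₂' : 𝓞 K3} (hcert₁' : mkInt a₁ b₁ * mkInt (a₁ - b₁) (-b₁) ^ 2 - zetaInt ^ c₁' * y₁' ^ 3 ∈ w₁.asIdeal)
    (hcert₂' : mkInt a₂ b₂ * mkInt (a₂ - b₂) (-b₂) ^ 2 - zetaInt ^ c₂' * y₂' ^ 3 ∈ w₁.asIdeal)
    {e₀ e₁ e₂ : ℕ} (hv₀ : 3 ∣ e₀ + c₁ * e₁ + c₂ * e₂)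
    (hsurv : ∀ k₁ k₂ : ℕ, k₁ < 3 → k₂ < 3 → 3 ∣ (c₁ + 2 * c₁') * k₁ + (c₂ + 2 * c₂') * k₂ →
      (k₁ = 0 ∧ k₂ = 0) ∨ (k₁ = e₁ ∧ k₂ = e₂) ∨ (k₁ = (2 * e₁) % 3 ∧ k₂ = (2 * e₂) % 3))
    (hgen₃ : ∀ θ₀ : K3, θ₀ ^ 2 = -3 →
      cubeClass ((zeta : K3) ^ e₀ * ((⟨a₁, b₁⟩ : K3) * (⟨a₁ - b₁, -b₁⟩ : K3) ^ 2) ^ e₁ *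
        ((⟨a₂, b₂⟩ : K3) * (⟨a₂ - b₂, -b₂⟩ : K3) ^ 2) ^ e₂) ∈ Subgroup.closure (Set.range
        fun P : (threeTorsionModel (algebraMap ℚ K3 m * θ₀) (algebraMap ℚ K3 (3 * s - 4 * m ^ 3 / 9) * θ₀)).toAffine.Point =>
          descentClass (threeTorsionModel (algebraMap ℚ K3 m * θ₀) (algebraMap ℚ K3 (3 * s - 4 * m ^ 3 / 9) * θ₀))
            (algebraMap ℚ K3 m * θ₀) (algebraMap ℚ K3 (3 * s - 4 * m ^ 3 / 9) * θ₀) P)) :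
    ∀ c' ∈ (threeTorsionModel m s).sha, 3 • c' = 0 → c' = 0 :=
  forall_mem_sha_three_nsmul_eq_zero_of_QKill_of_box S hS hout hp₀ hp₀1 hsp hDp hg hg0 c y hcert hy0 hq₀ hc₀ f hf hgenQ
    (fun θ₀ => -(algebraMap ℚ K3 m / 3) * θ₀) (fun θ₀ => -(algebraMap ℚ K3 s / 3) * θ₀)
    (fun _ hθ => canonical₃_b_ne_zero (m := m) hθ) (fun _ hθ => canonical₃_d_ne_zero hθ)
    (fun _ hθ => canonical₃_baseChange_eq hθ) (fun _ hθ => canonical₃_hy hθ)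
    (fun θ₀ hθ _ hu hsha hnorm => torsorClass_eq_zero_of_mem_sha_of_norm_cube_of_split₂_doubleKill hN0 hN hp₁ hp₁1 hab₁
      hp₂ hp₂1 hab₂ hne (canonical₃_b_ne_zero (m := m) hθ) (canonical₃_d_ne_zero hθ) (t := -1) (by norm_num) canonical₃_hm
      (canonical₃_hs hθ) (fun w hw => canonical₃_valuation_s hθ (not_mem_assocD₂ hw) (hvb w hw))
      (fun w hw => canonical₃_valuation_m hθ (not_mem_assocD₂ hw) (hvm w hw))
      w₀ hw₀ hw₀2 (canonical₃_valuation_s₃ hθ (not_mem_assocD₂ hw₀) hw₀2 (hvb w₀ hw₀))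
      (canonical₃_valuation_D hθ (not_mem_assocD₂ hw₀) hw₀s) hw₀9 hcert₁ hcert₂
      w₁ hw₁ hw₁2 (canonical₃_valuation_s₃ hθ (not_mem_assocD₂ hw₁) hw₁2 (hvb w₁ hw₁))
      (canonical₃_valuation_D hθ (not_mem_assocD₂ hw₁) hw₁s) hw₁9 hcert₁' hcert₂' hv₀ hsurv (hgen₃ θ₀ hθ) hu hsha hnorm)

/-- **`t_3(E_{m,s}) = 0` BOOKED: cut ℚ-box, two split primes, two `K3`-killing places, one `K3`-point.**
[cite: CohenPazuki2009, Proposition 2.2] [cite: SilvermanAEC2009, Thm. X.4.2 (a)] -/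
theorem shaCorank_three_eq_zero_of_QKill_split₂_doubleKill {m s : ℚ} [(threeTorsionModel m s).IsElliptic]
    (S : Finset ℕ) (hS : ∀ q ∈ S, q.Prime)
    (hout : ∀ q : ℕ, q.Prime → q ∉ S → padicValRat q (2 * s) = 0 ∧ 0 ≤ padicValRat q (2 * m))
    {p₀ : ℕ} (hp₀ : p₀.Prime) (hp₀1 : p₀ % 3 = 1)
    (hsp : padicValRat p₀ s = 0) (hDp : 0 < padicValRat p₀ (27 * s - 4 * m ^ 3))
    {g : ℕ} (hg : (g : ZMod p₀) ^ ((p₀ - 1) / 3) ≠ 1) (hg0 : (g : ZMod p₀) ≠ 0)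
    (c y : ℕ → ℕ) (hcert : ∀ q ∈ S, ((q : ℕ) : ZMod p₀) = (g : ZMod p₀) ^ c q * ((y q : ℕ) : ZMod p₀) ^ 3)
    (hy0 : ∀ q ∈ S, ((y q : ℕ) : ZMod p₀) ≠ 0)
    {q₀ : ℕ} (hq₀ : q₀ ∈ S) (hc₀ : ¬ 3 ∣ c q₀) (f : ℕ → ℕ) (hf : ∀ q ∈ S, q ≠ q₀ → 3 ∣ c q + c q₀ * f q)
    (hgenQ : ∀ q ∈ S, q ≠ q₀ → cubeClass ((q : ℚ) * (q₀ : ℚ) ^ f q) ∈ Subgroup.closure (Set.range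
      fun P : (threeTorsionModel m s).toAffine.Point => descentClass (threeTorsionModel m s) m s P))
    {N : ℕ} (hN0 : N ≠ 0) (hN : ∀ q ∈ N.primeFactors, q = 2 ∨ q % 3 = 2)
    {p₁ : ℕ} (hp₁ : p₁.Prime) (hp₁1 : p₁ % 3 = 1) {a₁ b₁ : ℤ} (hab₁ : a₁ ^ 2 - a₁ * b₁ + b₁ ^ 2 = p₁)
    {p₂ : ℕ} (hp₂ : p₂.Prime) (hp₂1 : p₂ % 3 = 1) {a₂ b₂ : ℤ} (hab₂ : a₂ ^ 2 - a₂ * b₂ + b₂ ^ 2 = p₂) (hne : p₁ ≠ p₂)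
    (hvb : ∀ w : HeightOneSpectrum (𝓞 K3), ((3 * N * p₁ * p₂ : ℕ) : 𝓞 K3) ∉ w.asIdeal →
      w.valuation K3 (algebraMap ℚ K3 (2 * (3 * s - 4 * m ^ 3 / 9))) = 1)
    (hvm : ∀ w : HeightOneSpectrum (𝓞 K3), ((3 * N * p₁ * p₂ : ℕ) : 𝓞 K3) ∉ w.asIdeal →
      w.valuation K3 (algebraMap ℚ K3 (2 * m)) ≤ 1)
    (w₀ : HeightOneSpectrum (𝓞 K3)) (hw₀ : ((3 * N * p₁ * p₂ : ℕ) : 𝓞 K3) ∉ w₀.asIdeal) (hw₀2 : w₀.valuation K3 2 = 1)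
    (hw₀s : w₀.valuation K3 (algebraMap ℚ K3 s) < 1) (hw₀9 : ¬ 9 ∣ Ideal.absNorm w₀.asIdeal - 1)
    {c₁ c₂ : ℕ} {y₁ y₂ : 𝓞 K3} (hcert₁ : mkInt a₁ b₁ * mkInt (a₁ - b₁) (-b₁) ^ 2 - zetaInt ^ c₁ * y₁ ^ 3 ∈ w₀.asIdeal)
    (hcert₂ : mkInt a₂ b₂ * mkInt (a₂ - b₂) (-b₂) ^ 2 - zetaInt ^ c₂ * y₂ ^ 3 ∈ w₀.asIdeal)
    (w₁ : HeightOneSpectrum (𝓞 K3)) (hw₁ : ((3 * N * p₁ * p₂ : ℕ) : 𝓞 K3) ∉ w₁.asIdeal) (hw₁2 : w₁.valuation K3 2 = 1)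
    (hw₁s : w₁.valuation K3 (algebraMap ℚ K3 s) < 1) (hw₁9 : ¬ 9 ∣ Ideal.absNorm w₁.asIdeal - 1)
    {c₁' c₂' : ℕ} {y₁' y₂' : 𝓞 K3} (hcert₁' : mkInt a₁ b₁ * mkInt (a₁ - b₁) (-b₁) ^ 2 - zetaInt ^ c₁' * y₁' ^ 3 ∈ w₁.asIdeal)
    (hcert₂' : mkInt a₂ b₂ * mkInt (a₂ - b₂) (-b₂) ^ 2 - zetaInt ^ c₂' * y₂' ^ 3 ∈ w₁.asIdeal)
    {e₀ e₁ e₂ : ℕ} (hv₀ : 3 ∣ e₀ + c₁ * e₁ + c₂ * e₂)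
    (hsurv : ∀ k₁ k₂ : ℕ, k₁ < 3 → k₂ < 3 → 3 ∣ (c₁ + 2 * c₁') * k₁ + (c₂ + 2 * c₂') * k₂ →
      (k₁ = 0 ∧ k₂ = 0) ∨ (k₁ = e₁ ∧ k₂ = e₂) ∨ (k₁ = (2 * e₁) % 3 ∧ k₂ = (2 * e₂) % 3))
    (hgen₃ : ∀ θ₀ : K3, θ₀ ^ 2 = -3 →
      cubeClass ((zeta : K3) ^ e₀ * ((⟨a₁, b₁⟩ : K3) * (⟨a₁ - b₁, -b₁⟩ : K3) ^ 2) ^ e₁ *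
        ((⟨a₂, b₂⟩ : K3) * (⟨a₂ - b₂, -b₂⟩ : K3) ^ 2) ^ e₂) ∈ Subgroup.closure (Set.range
        fun P : (threeTorsionModel (algebraMap ℚ K3 m * θ₀) (algebraMap ℚ K3 (3 * s - 4 * m ^ 3 / 9) * θ₀)).toAffine.Point =>
          descentClass (threeTorsionModel (algebraMap ℚ K3 m * θ₀) (algebraMap ℚ K3 (3 * s - 4 * m ^ 3 / 9) * θ₀))
            (algebraMap ℚ K3 m * θ₀) (algebraMap ℚ K3 (3 * s - 4 * m ^ 3 / 9) * θ₀) P)) :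
    (threeTorsionModel m s).shaCorank 3 = 0 :=
  haveI : Fact (Nat.Prime 3) := ⟨Nat.prime_three⟩
  shaCorank_eq_zero_of_forall _ 3 (forall_mem_sha_three_nsmul_eq_zero_of_QKill_split₂_doubleKill S hS hout hp₀ hp₀1 hsp hDp hg hg0 c y hcert hy0 hq₀ hc₀ f hf hgenQ
    hN0 hN hp₁ hp₁1 hab₁ hp₂ hp₂1 hab₂ hne hvb hvm w₀ hw₀ hw₀2 hw₀s hw₀9 hcert₁ hcert₂ w₁ hw₁ hw₁2 hw₁s hw₁9 hcert₁' hcert₂' hv₀ hsurv hgen₃)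

end CPMuDescent

end Literature.NumberTheory.EllipticCurves

end
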